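import Literature.NumberTheory.Sieve.MontgomeryVaughan1975BoxZeros
import Literature.NumberTheory.Sieve.MontgomeryVaughan1975Lemma43Tools
import HarnessLib

/-!
# Montgomery–Vaughan (1975), Lemma 4.3: the sum over the zeros of all `L(s, χ)`, `q ≤ P` —
nested form of the density lemma, and the location of the non-exceptional zeros — PROVED

H. L. Montgomery, R. C. Vaughan, *The exceptional set in Goldbach's problem*, Acta Arith. 27
(1975) 353–370 [MontgomeryVaughanActa1975], §4 Lemmas 4.1, 4.3; P. X. Gallagher, Invent. Math.
11 (1970), §5. Two further tools for the derivation of Lemma 4.3 (Gallagher's Theorem 7) from a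
log-free zero-density estimate:

* `sum_sum_sum_mul_rpow_le_of_density` — the density lemma
  `MontgomeryVaughan1975Lemma43Tools.sum_mul_rpow_sub_one_le_of_density` for a NESTED family of
  zeros `ρ ∈ Z k a`, `a ∈ F k`, `k ∈ I` (moduli `k = q`, characters `a = χ`, zeros `ρ`), with
  weights `m k a ρ ≥ 0` (multiplicities): if all `Re ρ ≤ 1 − η` and
  `∑_k ∑_a ∑_{ρ : α ≤ Re ρ} m ≤ A B^{1−α}` for `α ≤ 1 − η`, then for `x ≥ B²`,
  `∑_k ∑_a ∑_ρ m · x^{Re ρ − 1} ≤ 5A(B/x)^η`; and `…_of_density₀`, the same when the density bound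
  is only assumed for `0 ≤ α ≤ 1 − η` and all `Re ρ > 0`.
* `boxZero_re_le_of_exceptional` — in the presence of an exceptional datum `(r̃, χ̃, β̃)` at level
  `c` (Lemma 4.1 at `c`, `Lemma41At c P`: uniqueness), every zero `ρ` in the box `q ≤ P`,
  `|γ| ≤ P⁶` of a primitive `χ ≠ χ₀` OTHER than the zero `β̃` of `χ̃` itself satisfies
  `Re ρ ≤ 1 − c/log P` (from `exists_boxZero_isExceptional`); `boxZero_re_le_of_none` — the same
  for all zeros when no exceptional datum exists; `ofReal_mem_box_of_isExceptionalZero` — `β̃`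
  itself lies in the box.

No named facts.
-/

noncomputable section

open Finset Real

namespace Literature.NumberTheory.Sieve.MontgomeryVaughan1975

/-! ### The density lemma for a nested family of zeros -/

/-- **Nested form of the density lemma**: for finite families `I` (moduli), `F k` (characters)
and `Z k a ⊆ ℂ` (zeros) with weights `m k a ρ ≥ 0`, if every `Re ρ ≤ 1 − η` and
`∑_k ∑_a ∑_{ρ : α ≤ Re ρ} m k a ρ ≤ A B^{1−α}` for all `α ≤ 1 − η` (`A ≥ 0`, `B ≥ 1`), then for
`x ≥ B²` (`x > 1`): `∑_k ∑_a ∑_ρ m k a ρ · x^{Re ρ − 1} ≤ 5 A (B/x)^η`.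
[cite: Gallagher1970, §5] -/
theorem sum_sum_sum_mul_rpow_le_of_density {κ : Type*} {α : κ → Type*} (I : Finset κ)
    (F : ∀ k, Finset (α k)) (Z : ∀ k, α k → Finset ℂ) (m : ∀ k, α k → ℂ → ℝ)
    {x B A η : ℝ} (hx : 1 < x) (hB : 1 ≤ B) (hBx : B ^ 2 ≤ x) (hA : 0 ≤ A)
    (hm : ∀ k ∈ I, ∀ a ∈ F k, ∀ ρ ∈ Z k a, 0 ≤ m k a ρ)
    (hβ : ∀ k ∈ I, ∀ a ∈ F k, ∀ ρ ∈ Z k a, ρ.re ≤ 1 - η)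
    (hdens : ∀ α' : ℝ, α' ≤ 1 - η →
      ∑ k ∈ I, ∑ a ∈ F k, ∑ ρ ∈ (Z k a).filter (fun ρ => α' ≤ ρ.re), m k a ρ ≤
        A * B ^ (1 - α')) :
    ∑ k ∈ I, ∑ a ∈ F k, ∑ ρ ∈ Z k a, m k a ρ * x ^ (ρ.re - 1) ≤ 5 * A * (B / x) ^ η := by
  classical
  set s : Finset (Σ k, Σ _ : α k, ℂ) := I.sigma fun k => (F k).sigma fun a => Z k a with hs
  have hmem : ∀ i ∈ s, i.1 ∈ I ∧ i.2.1 ∈ F i.1 ∧ i.2.2 ∈ Z i.1 i.2.1 := by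
    intro i hi
    rw [hs, Finset.mem_sigma, Finset.mem_sigma] at hi
    exact ⟨hi.1, hi.2.1, hi.2.2⟩
  have key := sum_mul_rpow_sub_one_le_of_density s (fun i => i.2.2.re)
    (fun i => m i.1 i.2.1 i.2.2) hx hB hBx hA
    (fun i hi => by obtain ⟨h1, h2, h3⟩ := hmem i hi; exact hm _ h1 _ h2 _ h3)
    (fun i hi => by obtain ⟨h1, h2, h3⟩ := hmem i hi; exact hβ _ h1 _ h2 _ h3)
    (by
      intro α' hα'
      have h := hdens α' hα'
      have hre : ∑ i ∈ s with α' ≤ i.2.2.re, m i.1 i.2.1 i.2.2 =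
          ∑ k ∈ I, ∑ a ∈ F k, ∑ ρ ∈ (Z k a).filter (fun ρ => α' ≤ ρ.re), m k a ρ := by
        rw [Finset.sum_filter, hs, Finset.sum_sigma]
        refine Finset.sum_congr rfl fun k _ => ?_
        rw [Finset.sum_sigma]
        refine Finset.sum_congr rfl fun a _ => ?_
        rw [Finset.sum_filter]
      rw [hre]
      exact h)
  have hsum : ∑ i ∈ s, m i.1 i.2.1 i.2.2 * x ^ (i.2.2.re - 1) =
      ∑ k ∈ I, ∑ a ∈ F k, ∑ ρ ∈ Z k a, m k a ρ * x ^ (ρ.re - 1) := by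
    rw [hs, Finset.sum_sigma]
    refine Finset.sum_congr rfl fun k _ => ?_
    rw [Finset.sum_sigma]
  rw [← hsum]
  exact key

/-- **The same with the density bound on `[0, 1 − η]` only**, for zeros in the right half-plane
(`Re ρ > 0`; for `α < 0` the count is the count at `α = 0` and `B^{1−α} ≥ B`).
[cite: Gallagher1970, §5] -/
theorem sum_sum_sum_mul_rpow_le_of_density₀ {κ : Type*} {α : κ → Type*} (I : Finset κ)
    (F : ∀ k, Finset (α k)) (Z : ∀ k, α k → Finset ℂ) (m : ∀ k, α k → ℂ → ℝ)
    {x B A η : ℝ} (hx : 1 < x) (hB : 1 ≤ B) (hBx : B ^ 2 ≤ x) (hA : 0 ≤ A) (hη : η ≤ 1)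
    (hm : ∀ k ∈ I, ∀ a ∈ F k, ∀ ρ ∈ Z k a, 0 ≤ m k a ρ)
    (hpos : ∀ k ∈ I, ∀ a ∈ F k, ∀ ρ ∈ Z k a, 0 ≤ ρ.re)
    (hβ : ∀ k ∈ I, ∀ a ∈ F k, ∀ ρ ∈ Z k a, ρ.re ≤ 1 - η)
    (hdens : ∀ α' : ℝ, 0 ≤ α' → α' ≤ 1 - η →
      ∑ k ∈ I, ∑ a ∈ F k, ∑ ρ ∈ (Z k a).filter (fun ρ => α' ≤ ρ.re), m k a ρ ≤
        A * B ^ (1 - α')) :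
    ∑ k ∈ I, ∑ a ∈ F k, ∑ ρ ∈ Z k a, m k a ρ * x ^ (ρ.re - 1) ≤ 5 * A * (B / x) ^ η := by
  refine sum_sum_sum_mul_rpow_le_of_density I F Z m hx hB hBx hA hm hβ fun α' hα' => ?_
  rcases le_or_gt 0 α' with h0 | hneg
  · exact hdens α' h0 hα'
  · -- `α' < 0`: every zero counts, as at `α' = 0`, and `B^{1−α'} ≥ B^{1−0}`
    have h0 := hdens 0 le_rfl (by linarith)
    have hfilter : ∀ k ∈ I, ∀ a ∈ F k,
        ∑ ρ ∈ (Z k a).filter (fun ρ => α' ≤ ρ.re), m k a ρ =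
          ∑ ρ ∈ (Z k a).filter (fun ρ => (0 : ℝ) ≤ ρ.re), m k a ρ := by
      intro k hk a ha
      refine Finset.sum_congr ?_ fun _ _ => rfl
      ext ρ
      simp only [Finset.mem_filter]
      constructor
      · rintro ⟨hρ, -⟩; exact ⟨hρ, hpos k hk a ha ρ hρ⟩
      · rintro ⟨hρ, -⟩; exact ⟨hρ, by linarith [hpos k hk a ha ρ hρ]⟩
    have hB0 : 0 < B := by linarith
    calc ∑ k ∈ I, ∑ a ∈ F k, ∑ ρ ∈ (Z k a).filter (fun ρ => α' ≤ ρ.re), m k a ρ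
        = ∑ k ∈ I, ∑ a ∈ F k, ∑ ρ ∈ (Z k a).filter (fun ρ => (0 : ℝ) ≤ ρ.re), m k a ρ :=
          Finset.sum_congr rfl fun k hk => Finset.sum_congr rfl fun a ha => hfilter k hk a ha
      _ ≤ A * B ^ (1 - (0 : ℝ)) := h0
      _ ≤ A * B ^ (1 - α') :=
          mul_le_mul_of_nonneg_left (Real.rpow_le_rpow_of_exponent_le hB (by linarith)) hA

/-- **Single-family form with the density bound on `[0, 1 − η]` only** (zeros with `Re ρ ≥ 0`,
e.g. the zeros of `ζ` in `weilZeroIndex`). [cite: Gallagher1970, §5] -/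
theorem sum_mul_rpow_sub_one_le_of_density₀ {ι : Type*} (s : Finset ι) (β w : ι → ℝ)
    {x B A η : ℝ} (hx : 1 < x) (hB : 1 ≤ B) (hBx : B ^ 2 ≤ x) (hA : 0 ≤ A) (hη : η ≤ 1)
    (hw : ∀ i ∈ s, 0 ≤ w i) (hpos : ∀ i ∈ s, 0 ≤ β i) (hβ : ∀ i ∈ s, β i ≤ 1 - η)
    (hdens : ∀ α : ℝ, 0 ≤ α → α ≤ 1 - η → ∑ i ∈ s with α ≤ β i, w i ≤ A * B ^ (1 - α)) :
    ∑ i ∈ s, w i * x ^ (β i - 1) ≤ 5 * A * (B / x) ^ η := by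
  refine sum_mul_rpow_sub_one_le_of_density s β w hx hB hBx hA hw hβ fun α hα => ?_
  rcases le_or_gt 0 α with h0 | hneg
  · exact hdens α h0 hα
  · have h0 := hdens 0 le_rfl (by linarith)
    have hfilter : (s.filter fun i => α ≤ β i) = s.filter fun i => (0 : ℝ) ≤ β i := by
      ext i
      simp only [Finset.mem_filter]
      constructor
      · rintro ⟨hi, -⟩; exact ⟨hi, hpos i hi⟩
      · rintro ⟨hi, -⟩; exact ⟨hi, by linarith [hpos i hi]⟩
    rw [hfilter]
    refine h0.trans (mul_le_mul_of_nonneg_left ?_ hA)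
    exact Real.rpow_le_rpow_of_exponent_le hB (by linarith)

/-! ### The location of the non-exceptional zeros in the box `q ≤ P`, `|γ| ≤ P⁶` -/

/-- **No exceptional datum: all zeros in the box are `≤ 1 − c/log P`.** With the absolute `c_b`
of `exists_boxZero_isExceptional`: for `0 < c`, `9c ≤ c_b`, `P ≥ 2`, if there is no exceptional
datum at level `c`, every zero `ρ` (`|Im ρ| ≤ P⁶`) of a primitive `χ ≠ χ₀` mod `q ≤ P` has
`Re ρ ≤ 1 − c/log P`. [cite: MontgomeryVaughanActa1975, §4 Lemma 4.1] -/
theorem boxZero_re_le_of_none {c_b : ℝ}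
    (Hbox : ∀ A : ℝ, 1 ≤ A → ∀ c₀ P : ℝ, 0 < c₀ → c₀ * (A + 3) ≤ c_b → 2 ≤ P →
      ∀ (q : ℕ) [NeZero q] (χ : DirichletCharacter ℂ q), χ.IsPrimitive → χ ≠ 1 → (q : ℝ) ≤ P →
        ∀ ρ : ℂ, χ.LFunction ρ = 0 → |ρ.im| ≤ P ^ A → 1 - c₀ / Real.log P < ρ.re →
          ρ.im = 0 ∧ χ ^ 2 = 1 ∧ IsExceptionalZero c₀ P q χ ρ.re)
    {c P : ℝ} (hc : 0 < c) (hcb : 9 * c ≤ c_b) (hP : 2 ≤ P)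
    (hnone : ∀ (r : ℕ) [NeZero r] (χ : DirichletCharacter ℂ r) (β : ℝ), ¬ IsExceptionalZero c P r χ β)
    {q : ℕ} [NeZero q] {χ : DirichletCharacter ℂ q} (hprim : χ.IsPrimitive) (hχ : χ ≠ 1)
    (hq : (q : ℝ) ≤ P) {ρ : ℂ} (hρ : χ.LFunction ρ = 0) (hγ : |ρ.im| ≤ P ^ (6 : ℝ)) :
    ρ.re ≤ 1 - c / Real.log P := by
  by_contra hcon
  have h := Hbox 6 (by norm_num) c P hc (by linarith) hP q χ hprim hχ hq ρ hρ hγ (not_le.mp hcon)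
  exact hnone q χ ρ.re h.2.2

/-- **An exceptional datum `(r̃, χ̃, β̃)`: all OTHER zeros in the box are `≤ 1 − c/log P`.**
With `c_b` as above, `0 < c`, `9c ≤ c_b`, `P ≥ 2`, Lemma 4.1 at `c` (`Lemma41At c P`:
uniqueness of the exceptional datum) and an exceptional datum `(r̃, χ̃, β̃)`: every zero `ρ`
(`|Im ρ| ≤ P⁶`) of a primitive `χ ≠ χ₀` mod `q ≤ P`, other than the zero `ρ = β̃` of (a character
equal on `ℕ` to) `χ̃` mod `q = r̃`, has `Re ρ ≤ 1 − c/log P`.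
[cite: MontgomeryVaughanActa1975, §4 Lemma 4.1] -/
theorem boxZero_re_le_of_exceptional {c_b : ℝ}
    (Hbox : ∀ A : ℝ, 1 ≤ A → ∀ c₀ P : ℝ, 0 < c₀ → c₀ * (A + 3) ≤ c_b → 2 ≤ P →
      ∀ (q : ℕ) [NeZero q] (χ : DirichletCharacter ℂ q), χ.IsPrimitive → χ ≠ 1 → (q : ℝ) ≤ P →
        ∀ ρ : ℂ, χ.LFunction ρ = 0 → |ρ.im| ≤ P ^ A → 1 - c₀ / Real.log P < ρ.re →
          ρ.im = 0 ∧ χ ^ 2 = 1 ∧ IsExceptionalZero c₀ P q χ ρ.re)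
    {c P : ℝ} (hc : 0 < c) (hcb : 9 * c ≤ c_b) (hP : 2 ≤ P) (h41 : Lemma41At c P)
    {r : ℕ} [NeZero r] {χe : DirichletCharacter ℂ r} {β : ℝ} (hEZ : IsExceptionalZero c P r χe β)
    {q : ℕ} [NeZero q] {χ : DirichletCharacter ℂ q} (hprim : χ.IsPrimitive) (hχ : χ ≠ 1)
    (hq : (q : ℝ) ≤ P) {ρ : ℂ} (hρ : χ.LFunction ρ = 0) (hγ : |ρ.im| ≤ P ^ (6 : ℝ))
    (hne : ¬ (q = r ∧ (∀ n : ℕ, χ (n : ZMod q) = χe (n : ZMod r)) ∧ ρ = (β : ℂ))) :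
    ρ.re ≤ 1 - c / Real.log P := by
  by_contra hcon
  obtain ⟨him, -, hEZ'⟩ :=
    Hbox 6 (by norm_num) c P hc (by linarith) hP q χ hprim hχ hq ρ hρ hγ (not_le.mp hcon)
  obtain ⟨hqr, hβ, hχχ⟩ := h41.2 q r χ χe ρ.re β hEZ' hEZ
  apply hne
  refine ⟨hqr, hχχ, ?_⟩
  apply Complex.ext
  · simp [hβ]
  · simp [him]

/-- The exceptional zero itself lies in the box: `L(β̃, χ̃) = 0`, `0 < β̃ < 1`, `|Im β̃| = 0 ≤ T`
(for `c < log P`, e.g. `c ≤ 1/2`, `P ≥ 2`). [cite: MontgomeryVaughanActa1975, §4 Lemma 4.1] -/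
theorem ofReal_mem_box_of_isExceptionalZero {c P : ℝ} (hc : 0 < c) (hc2 : c ≤ 1 / 2) (hP : 2 ≤ P)
    {r : ℕ} [NeZero r] {χ : DirichletCharacter ℂ r} {β : ℝ} (h : IsExceptionalZero c P r χ β)
    {T : ℝ} (hT : 0 ≤ T) :
    χ.LFunction (β : ℂ) = 0 ∧ 0 < (β : ℂ).re ∧ (β : ℂ).re < 1 ∧ |(β : ℂ).im| ≤ T := by
  obtain ⟨-, -, -, hβ, hβ1, hzero⟩ := h
  have hlog2 : (1 / 2 : ℝ) < Real.log P := by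
    have h2 : Real.log 2 ≤ Real.log P := Real.log_le_log two_pos hP
    have := Real.log_two_gt_d9
    linarith
  have hlogP : 0 < Real.log P := by linarith
  have hlt : c / Real.log P < 1 := by rw [div_lt_one hlogP]; linarith
  refine ⟨hzero, ?_, ?_, ?_⟩
  · simp only [Complex.ofReal_re]; linarith
  · simpa using hβ1
  · simpa using hT

end Literature.NumberTheory.Sieve.MontgomeryVaughan1975
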